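/-
VALUE = THEOREM (a generic, once-checked reduction of a reflection-class exclusion in `GL₃(𝔽_p)`
to one Boolean certificate `cert (KS p σ) σ c X₀`), NOT summit progress (cell b2b-lgcu-borel,
gen 23); the crux item stmt-MatrixMultiplication-14079 is untouched.
-/
import Mathlib
import Summits.MatrixMultiplication.MatrixMultiplication.Theorems.SubgroupIdentityDesigns.Negative.PermutationCertificate
import Summits.MatrixMultiplication.MatrixMultiplication.Theorems.SubgroupIdentityDesigns.Negative.NonsquareReflectionsFour

/-!
# Reflection classes of `GL₃(𝔽_p)`: the decidable certificate form

VALUE = THEOREM (generic in `p`; a per-prime instance is then ONE `native_decide`), NOT summit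
progress; the crux item stmt-MatrixMultiplication-14079 is untouched and remains open.

For `m = 3` the reflection class of sign `−χ(−1)` — `K = ⟨R_b : χ(b·b) = −χ(−1)⟩`, i.e. the
non-square class `K_p⁻ ≅ PGL₂(𝔽_p)` for `p ≡ 1 (mod 4)` and the square class `Ω₃(𝔽_p) × ⟨−1⟩`
for `p ≡ 3 (mod 4)` — is the one class no structural criterion of this folder reaches.  This
file packages the permutation certificate of `PermutationCertificate` for BOTH classes
(`σ = true`: square, `σ = false`: non-square) into one Boolean

  `cert (KS p σ) σ c X₀`  (`KS·R ⊆ KS`, `KS⁻¹ ⊆ KS`, `KS ⊆ O₃ ∩ {det² = 1}`, `w(X₀) ≠ 0`, and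
  the stabiliser orbit-sum test `orbitTest` for every `x ≠ 0`),

where `KS p σ` = the words of length `≤ 4` in the reflections of the class (materialised
entrywise), the action is the untwisted `k ⋆ v = det(k)·(k v)` on `𝔽_p³`, and the weight is the
UNIFIED closed form on the sphere `v·v = c` with base point `X₀` (`w = 0` off the sphere)

  `w(v) = χ(−1)(χ(Q(v+X₀)) − χ(Q(v−X₀))) + (1 − χ(−1))·χ(2v·X₀) + p([v = X₀] − [v = −X₀])`

(`χ` the quadratic character; for `p ≡ 1 (4)` this is `χ(Q(v+X₀)) − χ(Q(v−X₀)) + poles`, for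
`p ≡ 3 (4)` it is `χ(Q(v−X₀)) − χ(Q(v+X₀)) + 2χ(2v·X₀) + poles`; found by solving for the
latitude vectors of the missing block, `code/g23/mirror_fit.py`, and checked for `p = 5, 7, 11,
13` exactly and for `p = 17, 19, 23, 29, 31` by sampling, `code/g23/perm_cert2.py`).

MAIN: `no_design_of_cert` (a `true` certificate excludes every triple whose product set covers
`classGroup p σ ∖ 1`) and the member forms `no_design_sq_mem₁/₂/₃_of_cert` /
`no_design_nsq_mem₁/₂/₃_of_cert` for every `m ≥ 3` (three coordinates, `SummandTransport`).
Instances: `SquareReflectionsSeven` (`p = 7`); further primes are one `native_decide` each; the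
all-`p` theorem (character sums over `PGL₂(𝔽_p)`) is the successor's target (ORACLE-g23 §G23-4).
HONEST SCOPE.  A reduction; by itself it excludes nothing.
-/

set_option linter.dupNamespace false

open scoped BigOperators Matrix

namespace Summit.MatrixMultiplication.MatrixMultiplication.Theorems.SubgroupIdentityDesigns.Negative
namespace ReflectionClassCertificate

open Summit.MatrixMultiplication.MatrixMultiplication.Theorems.LieRankDesigns.Negative (GLm Mat)
open NonsquareReflections (refl extVec extVec_dotProduct emb_refl)
open SummandTransport (emb design_comap)
open PermutationCertificate (no_design_of_permCert)

variable {p : ℕ} [hp : Fact p.Prime]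

/-- `𝔽_p³`. -/
abbrev V (p : ℕ) : Type := Fin 3 → ZMod p

/-! ## The class as data: words in the reflections -/

/-- Re-materialise a `3 × 3` matrix entrywise (compiled evaluation of iterated products then does
not re-expand closures). -/
def mat9 (M : Mat p 3) : Mat p 3 :=
  !![M 0 0, M 0 1, M 0 2; M 1 0, M 1 1, M 1 2; M 2 0, M 2 1, M 2 2]

omit hp in
/-- `mat9 M = M`. -/
theorem mat9_eq (M : Mat p 3) : mat9 M = M :=
  Matrix.ext fun i j => by fin_cases i <;> fin_cases j <;> rfl

/-- Re-materialise a unit of `GL₃(𝔽_p)` entrywise. -/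
def norm (g : GLm p 3) : GLm p 3 :=
  ⟨mat9 (g : Mat p 3), mat9 ((g⁻¹ : GLm p 3) : Mat p 3),
    by rw [mat9_eq, mat9_eq, ← Units.val_mul, mul_inv_cancel, Units.val_one],
    by rw [mat9_eq, mat9_eq, ← Units.val_mul, inv_mul_cancel, Units.val_one]⟩

omit hp in
/-- `norm g = g`. -/
theorem norm_eq (g : GLm p 3) : norm g = g := Units.ext (mat9_eq _)

/-- The reflections of the class `σ` (`σ = true`: `b·b` a non-zero square; `false`: a
non-square). -/
def R (p : ℕ) [Fact p.Prime] (σ : Bool) : Finset (GLm p 3) :=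
  (Finset.univ.filter fun b : V p => b ⬝ᵥ b ≠ 0 ∧ decide (IsSquare (b ⬝ᵥ b)) = σ).image
    fun b => norm (refl b)

/-- One closure step `S ↦ S ∪ S·R`. -/
def step (σ : Bool) (S : Finset (GLm p 3)) : Finset (GLm p 3) :=
  S ∪ (S ×ˢ R p σ).image fun ab => norm (ab.1 * ab.2)

/-- The words of length `≤ 4` in the reflections of the class (`= the class`, for the primes where
`cert` evaluates to `true`). -/
def KS (p : ℕ) [Fact p.Prime] (σ : Bool) : Finset (GLm p 3) :=
  step σ (step σ (step σ (step σ {1})))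

/-- `1 ∈ KS`. -/
theorem one_mem_KS (σ : Bool) : (1 : GLm p 3) ∈ KS p σ :=
  Finset.subset_union_left (Finset.subset_union_left (Finset.subset_union_left
    (Finset.subset_union_left (Finset.mem_singleton_self 1))))

/-- A subgroup containing the reflections of the class and `S` contains `step S`. -/
theorem step_sub {σ : Bool} {H : Subgroup (GLm p 3)}
    (hR : ∀ b : V p, b ⬝ᵥ b ≠ 0 → decide (IsSquare (b ⬝ᵥ b)) = σ → refl b ∈ H)
    {S : Finset (GLm p 3)} (hS : ∀ k ∈ S, k ∈ H) : ∀ k ∈ step σ S, k ∈ H := by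
  intro k hk
  unfold step at hk
  rcases Finset.mem_union.mp hk with hk | hk
  · exact hS k hk
  · obtain ⟨ab, hab, rfl⟩ := Finset.mem_image.mp hk
    obtain ⟨ha, hb⟩ := Finset.mem_product.mp hab
    unfold R at hb
    obtain ⟨b, hb', hbe⟩ := Finset.mem_image.mp hb
    rw [norm_eq]
    refine H.mul_mem (hS _ ha) ?_
    rw [← hbe, norm_eq]
    exact hR b (Finset.mem_filter.mp hb').2.1 (Finset.mem_filter.mp hb').2.2

/-- **`KS` lies in every subgroup containing the reflections of the class.** -/
theorem KS_sub {σ : Bool} {H : Subgroup (GLm p 3)}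
    (hR : ∀ b : V p, b ⬝ᵥ b ≠ 0 → decide (IsSquare (b ⬝ᵥ b)) = σ → refl b ∈ H) :
    ∀ k ∈ KS p σ, k ∈ H :=
  step_sub hR (step_sub hR (step_sub hR (step_sub hR fun k hk => by
    rw [Finset.mem_singleton.mp hk]; exact H.one_mem)))

/-- Induction step for closure under products: if `KS·R ⊆ KS` and `KS·S ⊆ KS` then
`KS·step S ⊆ KS`. -/
theorem mul_step {σ : Bool} {S : Finset (GLm p 3)}
    (h : ∀ k ∈ KS p σ, ∀ r ∈ R p σ, k * r ∈ KS p σ)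
    (hS : ∀ a ∈ KS p σ, ∀ b ∈ S, a * b ∈ KS p σ) :
    ∀ a ∈ KS p σ, ∀ b ∈ step σ S, a * b ∈ KS p σ := by
  intro a ha b hb
  unfold step at hb
  rcases Finset.mem_union.mp hb with hb | hb
  · exact hS a ha b hb
  · obtain ⟨ab, hab, rfl⟩ := Finset.mem_image.mp hb
    obtain ⟨h1, h2⟩ := Finset.mem_product.mp hab
    rw [norm_eq, ← mul_assoc]
    exact h _ (hS a ha _ h1) _ h2

/-- **Closure under products from the one-step check `KS·R ⊆ KS`** (words of length `≤ 4` times a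
generator stay words of length `≤ 4`, hence all words do). -/
theorem KS_mul_of_step {σ : Bool}
    (hst : ((KS p σ ×ˢ R p σ).filter fun kr => ¬ norm (kr.1 * kr.2) ∈ KS p σ) = ∅) :
    ∀ a ∈ KS p σ, ∀ b ∈ KS p σ, a * b ∈ KS p σ := by
  have h : ∀ k ∈ KS p σ, ∀ r ∈ R p σ, k * r ∈ KS p σ := fun k hk r hr => by
    have h' := not_not.mp (Finset.filter_eq_empty_iff.mp hst (Finset.mk_mem_product hk hr))
    rwa [norm_eq] at h'
  have h0 : ∀ a ∈ KS p σ, ∀ b ∈ ({1} : Finset (GLm p 3)), a * b ∈ KS p σ := fun a ha b hb => by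
    rw [Finset.mem_singleton.mp hb, mul_one]; exact ha
  intro a ha b hb
  have hb' : b ∈ step σ (step σ (step σ (step σ {1}))) := hb
  exact mul_step h (mul_step h (mul_step h (mul_step h h0))) a ha b hb'

/-- Closure under inverses from the check. -/
theorem KS_inv_of {σ : Bool} (hinv : ((KS p σ).filter fun a => ¬ a⁻¹ ∈ KS p σ) = ∅) :
    ∀ a ∈ KS p σ, a⁻¹ ∈ KS p σ := fun _ ha =>
  not_not.mp (Finset.filter_eq_empty_iff.mp hinv ha)

/-! ## The certificate: untwisted action and the unified weight -/

/-- The `3 × 3` determinant, written out. -/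
def det3 (M : Mat p 3) : ZMod p :=
  M 0 0 * M 1 1 * M 2 2 - M 0 0 * M 1 2 * M 2 1 - M 0 1 * M 1 0 * M 2 2 + M 0 1 * M 1 2 * M 2 0 +
    M 0 2 * M 1 0 * M 2 1 - M 0 2 * M 1 1 * M 2 0

/-- `det3 = det`. -/
theorem det3_eq (M : Mat p 3) : det3 M = M.det := (Matrix.det_fin_three M).symm

/-- The untwisted action `k ⋆ v = det(k) · (k v)` of `GL₃(𝔽_p)` on `𝔽_p³`. -/
def act (s : GLm p 3) (v : V p) : V p := det3 (s : Mat p 3) • ((s : Mat p 3) *ᵥ v)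

/-- `act` is multiplicative. -/
theorem act_mul (a b : GLm p 3) (v : V p) : act (a * b) v = act a (act b v) := by
  simp only [act, det3_eq, Units.val_mul, Matrix.det_mul, ← Matrix.mulVec_mulVec,
    Matrix.mulVec_smul, smul_smul]

/-- `act 1 = id`. -/
theorem act_one (v : V p) : act 1 v = v := by
  simp only [act, det3_eq, Units.val_one, Matrix.det_one, Matrix.one_mulVec, one_smul]

/-- An orthogonal `k` with `det(k)² = 1` preserves `v·v` under `act`. -/
theorem dot_act {k : GLm p 3} (hk : ((k : Mat p 3))ᵀ * (k : Mat p 3) = 1)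
    (hd : det3 (k : Mat p 3) * det3 (k : Mat p 3) = 1) (v : V p) :
    act k v ⬝ᵥ act k v = v ⬝ᵥ v := by
  have h1 : ((k : Mat p 3) *ᵥ v) ⬝ᵥ ((k : Mat p 3) *ᵥ v) = v ⬝ᵥ v := by
    rw [Matrix.dotProduct_mulVec, ← Matrix.vecMul_transpose, Matrix.vecMul_vecMul, hk,
      Matrix.vecMul_one]
  simp only [act, smul_dotProduct, dotProduct_smul, smul_eq_mul, h1, ← mul_assoc, hd, one_mul]

/-- The quadratic character of `𝔽_p` as an integer (`0 ↦ 0`). -/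
def chi (a : ZMod p) : ℤ := if a = 0 then 0 else if IsSquare a then 1 else -1

/-- The unified weight on the sphere `v·v = c` with base point `X₀` (`0` off the sphere):
`χ(−1)(χ(Q(v+X₀)) − χ(Q(v−X₀))) + (1 − χ(−1))χ(2v·X₀) + p([v = X₀] − [v = −X₀])`. -/
def wt (c : ZMod p) (X₀ : V p) (v : V p) : ℤ :=
  if v ⬝ᵥ v = c then
    chi (-1 : ZMod p) * (chi ((v + X₀) ⬝ᵥ (v + X₀)) - chi ((v - X₀) ⬝ᵥ (v - X₀))) +
      (1 - chi (-1 : ZMod p)) * chi (2 * (v ⬝ᵥ X₀)) +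
      ((if v = X₀ then (p : ℤ) else 0) - (if v = -X₀ then (p : ℤ) else 0))
  else 0

/-- Off the sphere the weight vanishes. -/
theorem wt_off {c : ZMod p} {X₀ v : V p} (hv : v ⬝ᵥ v ≠ c) : wt c X₀ v = 0 := if_neg hv
/-- The orbit-sum test at one `x`: the twisted stabiliser `{s ∈ S : s x = x}` is materialised once
and `Σ_s w(s ⋆ ω) = 0` is tested for every `ω` on the sphere. -/
def orbitTest (S : Finset (GLm p 3)) (c : ZMod p) (X₀ : V p) (x : V p) : Bool :=
  let Sx := S.filter fun s : GLm p 3 => (s : Mat p 3) *ᵥ x = x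
  decide (∀ ω : V p, ω ⬝ᵥ ω = c → (∑ s ∈ Sx, wt c X₀ (act s ω)) = 0)

/-- **THE DECIDABLE CERTIFICATE** of the class `σ` at the prime `p` (sphere `c`, base point `X₀`;
`S` = the class as data, instantiated with the closed term `KS p σ` so that compiled evaluation
computes it once), as a Boolean: `KS·R ⊆ KS`, `KS⁻¹ ⊆ KS`, `KS ⊆ O₃ ∩ {det² = 1}`,
`w(X₀) ≠ 0`, every `x ≠ 0` passes `orbitTest`. -/
def cert (S : Finset (GLm p 3)) (σ : Bool) (c : ZMod p) (X₀ : V p) : Bool :=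
  decide (((S ×ˢ R p σ).filter fun kr => ¬ norm (kr.1 * kr.2) ∈ S) = ∅) &&
  (decide ((S.filter fun a => ¬ a⁻¹ ∈ S) = ∅) &&
  (decide ((S.filter fun k : GLm p 3 => ¬ (((k : Mat p 3))ᵀ * (k : Mat p 3) = 1 ∧
      det3 (k : Mat p 3) * det3 (k : Mat p 3) = 1)) = ∅) &&
  (decide (wt c X₀ X₀ ≠ 0) && decide (∀ x : V p, x ≠ 0 → orbitTest S c X₀ x = true))))

/-- Unpacking a verified certificate. -/
theorem cert_spec {S : Finset (GLm p 3)} {σ : Bool} {c : ZMod p} {X₀ : V p}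
    (h : cert S σ c X₀ = true) :
    ((S ×ˢ R p σ).filter fun kr => ¬ norm (kr.1 * kr.2) ∈ S) = ∅ ∧
    (S.filter fun a => ¬ a⁻¹ ∈ S) = ∅ ∧
    (S.filter fun k : GLm p 3 => ¬ (((k : Mat p 3))ᵀ * (k : Mat p 3) = 1 ∧
      det3 (k : Mat p 3) * det3 (k : Mat p 3) = 1)) = ∅ ∧
    wt c X₀ X₀ ≠ 0 ∧ ∀ x : V p, x ≠ 0 → orbitTest S c X₀ x = true := by
  unfold cert at h
  simp only [Bool.and_eq_true, decide_eq_true_eq] at h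
  exact h

/-- The stabiliser orbit sums vanish, in the form the engine consumes. -/
theorem orbit_sums_of {σ : Bool} {c : ZMod p} {X₀ : V p}
    (horth : ((KS p σ).filter fun k : GLm p 3 => ¬ (((k : Mat p 3))ᵀ * (k : Mat p 3) = 1 ∧
      det3 (k : Mat p 3) * det3 (k : Mat p 3) = 1)) = ∅)
    (htest : ∀ x : V p, x ≠ 0 → orbitTest (KS p σ) c X₀ x = true) :
    ∀ x : V p, x ≠ 0 → ∀ ω : V p,
      (∑ s ∈ (KS p σ).filter (fun s : GLm p 3 => (s : Mat p 3) *ᵥ x = x),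
        wt c X₀ (act s ω)) = 0 := by
  intro x hx ω
  by_cases hω : ω ⬝ᵥ ω = c
  · have h := htest x hx
    unfold orbitTest at h
    simp only [decide_eq_true_eq] at h
    exact h ω hω
  · refine Finset.sum_eq_zero fun s hs => wt_off ?_
    have hk := not_not.mp (Finset.filter_eq_empty_iff.mp horth (Finset.mem_filter.mp hs).1)
    rwa [dot_act hk.1 hk.2]

/-! ## The exclusions -/

/-- The subgroup generated by the reflections of the class `σ`. -/
def classGroup (p : ℕ) [Fact p.Prime] (σ : Bool) : Subgroup (GLm p 3) :=
  Subgroup.closure {g | ∃ b : V p, b ⬝ᵥ b ≠ 0 ∧ decide (IsSquare (b ⬝ᵥ b)) = σ ∧ g = refl b}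

section Exclusions

variable {m : ℕ} {σ : Bool} {c : ZMod p} {X₀ : V p}

/-- **COVER FORM.**  A verified certificate excludes every triple whose product set covers the
class minus `1`. -/
theorem no_design_of_cert {H₁ H₂ H₃ : Subgroup (GLm p 3)} (hc : cert (KS p σ) σ c X₀ = true)
    (hmem : ∀ k ∈ classGroup p σ, k ≠ 1 → ∃ a ∈ H₁, ∃ b ∈ H₂, ∃ g ∈ H₃, a * b * g = k) :
    ¬ ∃ f : Mat p 3 → ℂ, (∀ M, 1 < M.rank → f M = 0) ∧
      (∑ M, f M * ZMod.stdAddChar (Matrix.trace (M * ((1 : GLm p 3) : Mat p 3)))) = 1 ∧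
      ∀ a ∈ H₁, ∀ b ∈ H₂, ∀ g ∈ H₃, a * b * g ≠ 1 →
        (∑ M, f M * ZMod.stdAddChar (Matrix.trace (M * ((a * b * g : GLm p 3) : Mat p 3)))) = 0 :=
  by
  have hc' := cert_spec hc
  exact no_design_of_permCert (KS p σ) (one_mem_KS σ) (KS_mul_of_step hc'.1) (KS_inv_of hc'.2.1) act
    act_mul act_one (wt c X₀) ⟨X₀, hc'.2.2.2.1⟩ (orbit_sums_of hc'.2.2.1 hc'.2.2.2.2)
    fun k hk hk1 => hmem k (KS_sub (H := classGroup p σ)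
      (fun b hb0 hb => Subgroup.subset_closure ⟨b, hb0, hb, rfl⟩) k hk) hk1

/-- **SQUARE CLASS: once `cert (KS p true) true c X₀ = true` is evaluated, NO MEMBER OF A TRIPLE
IN `GL_m(𝔽_p)`, `m ≥ 3`, CONTAINS ALL SQUARE REFLECTIONS of `𝔽_p^m`** (three coordinates
suffice): member `1`. -/
theorem no_design_sq_mem₁_of_cert (hc : cert (KS p true) true c X₀ = true) (hm : 3 ≤ m)
    {H₁ H₂ H₃ : Subgroup (GLm p m)}
    (h₁ : ∀ b : Fin m → ZMod p, b ⬝ᵥ b ≠ 0 → IsSquare (b ⬝ᵥ b) → refl b ∈ H₁) :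
    ¬ ∃ f : Mat p m → ℂ, (∀ M, 1 < M.rank → f M = 0) ∧
      (∑ M, f M * ZMod.stdAddChar (Matrix.trace (M * ((1 : GLm p m) : Mat p m)))) = 1 ∧
      ∀ a ∈ H₁, ∀ b ∈ H₂, ∀ g ∈ H₃, a * b * g ≠ 1 →
        (∑ M, f M * ZMod.stdAddChar (Matrix.trace (M * ((a * b * g : GLm p m) : Mat p m)))) = 0 :=
  by
  obtain ⟨l, rfl⟩ := Nat.exists_eq_add_of_le hm
  intro hdes
  refine no_design_of_cert (H₁ := H₁.comap (emb finSumFinEquiv))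
    (H₂ := H₂.comap (emb finSumFinEquiv)) (H₃ := H₃.comap (emb finSumFinEquiv)) hc
    (triple_of_le₁ ((Subgroup.closure_le _).mpr ?_)) (design_comap finSumFinEquiv 1 hdes)
  rintro _ ⟨b, hb0, hb, rfl⟩
  refine Subgroup.mem_comap.mpr ?_
  rw [emb_refl]
  exact h₁ _ (by rwa [extVec_dotProduct]) (by rw [extVec_dotProduct]; exact of_decide_eq_true hb)

/-- Square class, member `2`. -/
theorem no_design_sq_mem₂_of_cert (hc : cert (KS p true) true c X₀ = true) (hm : 3 ≤ m)
    {H₁ H₂ H₃ : Subgroup (GLm p m)}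
    (h₂ : ∀ b : Fin m → ZMod p, b ⬝ᵥ b ≠ 0 → IsSquare (b ⬝ᵥ b) → refl b ∈ H₂) :
    ¬ ∃ f : Mat p m → ℂ, (∀ M, 1 < M.rank → f M = 0) ∧
      (∑ M, f M * ZMod.stdAddChar (Matrix.trace (M * ((1 : GLm p m) : Mat p m)))) = 1 ∧
      ∀ a ∈ H₁, ∀ b ∈ H₂, ∀ g ∈ H₃, a * b * g ≠ 1 →
        (∑ M, f M * ZMod.stdAddChar (Matrix.trace (M * ((a * b * g : GLm p m) : Mat p m)))) = 0 :=
  by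
  obtain ⟨l, rfl⟩ := Nat.exists_eq_add_of_le hm
  intro hdes
  refine no_design_of_cert (H₁ := H₁.comap (emb finSumFinEquiv))
    (H₂ := H₂.comap (emb finSumFinEquiv)) (H₃ := H₃.comap (emb finSumFinEquiv)) hc
    (triple_of_le₂ ((Subgroup.closure_le _).mpr ?_)) (design_comap finSumFinEquiv 1 hdes)
  rintro _ ⟨b, hb0, hb, rfl⟩
  refine Subgroup.mem_comap.mpr ?_
  rw [emb_refl]
  exact h₂ _ (by rwa [extVec_dotProduct]) (by rw [extVec_dotProduct]; exact of_decide_eq_true hb)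

/-- Square class, member `3`. -/
theorem no_design_sq_mem₃_of_cert (hc : cert (KS p true) true c X₀ = true) (hm : 3 ≤ m)
    {H₁ H₂ H₃ : Subgroup (GLm p m)}
    (h₃ : ∀ b : Fin m → ZMod p, b ⬝ᵥ b ≠ 0 → IsSquare (b ⬝ᵥ b) → refl b ∈ H₃) :
    ¬ ∃ f : Mat p m → ℂ, (∀ M, 1 < M.rank → f M = 0) ∧
      (∑ M, f M * ZMod.stdAddChar (Matrix.trace (M * ((1 : GLm p m) : Mat p m)))) = 1 ∧
      ∀ a ∈ H₁, ∀ b ∈ H₂, ∀ g ∈ H₃, a * b * g ≠ 1 →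
        (∑ M, f M * ZMod.stdAddChar (Matrix.trace (M * ((a * b * g : GLm p m) : Mat p m)))) = 0 :=
  by
  obtain ⟨l, rfl⟩ := Nat.exists_eq_add_of_le hm
  intro hdes
  refine no_design_of_cert (H₁ := H₁.comap (emb finSumFinEquiv))
    (H₂ := H₂.comap (emb finSumFinEquiv)) (H₃ := H₃.comap (emb finSumFinEquiv)) hc
    (triple_of_le₃ ((Subgroup.closure_le _).mpr ?_)) (design_comap finSumFinEquiv 1 hdes)
  rintro _ ⟨b, hb0, hb, rfl⟩
  refine Subgroup.mem_comap.mpr ?_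
  rw [emb_refl]
  exact h₃ _ (by rwa [extVec_dotProduct]) (by rw [extVec_dotProduct]; exact of_decide_eq_true hb)

/-- **NON-SQUARE CLASS: once `cert (KS p false) false c X₀ = true` is evaluated, no member of a
triple in `GL_m(𝔽_p)`, `m ≥ 3`, contains all non-square reflections**: member `1`. -/
theorem no_design_nsq_mem₁_of_cert (hc : cert (KS p false) false c X₀ = true) (hm : 3 ≤ m)
    {H₁ H₂ H₃ : Subgroup (GLm p m)}
    (h₁ : ∀ b : Fin m → ZMod p, ¬ IsSquare (b ⬝ᵥ b) → refl b ∈ H₁) :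
    ¬ ∃ f : Mat p m → ℂ, (∀ M, 1 < M.rank → f M = 0) ∧
      (∑ M, f M * ZMod.stdAddChar (Matrix.trace (M * ((1 : GLm p m) : Mat p m)))) = 1 ∧
      ∀ a ∈ H₁, ∀ b ∈ H₂, ∀ g ∈ H₃, a * b * g ≠ 1 →
        (∑ M, f M * ZMod.stdAddChar (Matrix.trace (M * ((a * b * g : GLm p m) : Mat p m)))) = 0 :=
  by
  obtain ⟨l, rfl⟩ := Nat.exists_eq_add_of_le hm
  intro hdes
  refine no_design_of_cert (H₁ := H₁.comap (emb finSumFinEquiv))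
    (H₂ := H₂.comap (emb finSumFinEquiv)) (H₃ := H₃.comap (emb finSumFinEquiv)) hc
    (triple_of_le₁ ((Subgroup.closure_le _).mpr ?_)) (design_comap finSumFinEquiv 1 hdes)
  rintro _ ⟨b, -, hb, rfl⟩
  refine Subgroup.mem_comap.mpr ?_
  rw [emb_refl]
  exact h₁ _ (by rw [extVec_dotProduct]; exact of_decide_eq_false hb)

/-- Non-square class, member `2`. -/
theorem no_design_nsq_mem₂_of_cert (hc : cert (KS p false) false c X₀ = true) (hm : 3 ≤ m)
    {H₁ H₂ H₃ : Subgroup (GLm p m)}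
    (h₂ : ∀ b : Fin m → ZMod p, ¬ IsSquare (b ⬝ᵥ b) → refl b ∈ H₂) :
    ¬ ∃ f : Mat p m → ℂ, (∀ M, 1 < M.rank → f M = 0) ∧
      (∑ M, f M * ZMod.stdAddChar (Matrix.trace (M * ((1 : GLm p m) : Mat p m)))) = 1 ∧
      ∀ a ∈ H₁, ∀ b ∈ H₂, ∀ g ∈ H₃, a * b * g ≠ 1 →
        (∑ M, f M * ZMod.stdAddChar (Matrix.trace (M * ((a * b * g : GLm p m) : Mat p m)))) = 0 :=
  by
  obtain ⟨l, rfl⟩ := Nat.exists_eq_add_of_le hm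
  intro hdes
  refine no_design_of_cert (H₁ := H₁.comap (emb finSumFinEquiv))
    (H₂ := H₂.comap (emb finSumFinEquiv)) (H₃ := H₃.comap (emb finSumFinEquiv)) hc
    (triple_of_le₂ ((Subgroup.closure_le _).mpr ?_)) (design_comap finSumFinEquiv 1 hdes)
  rintro _ ⟨b, -, hb, rfl⟩
  refine Subgroup.mem_comap.mpr ?_
  rw [emb_refl]
  exact h₂ _ (by rw [extVec_dotProduct]; exact of_decide_eq_false hb)

/-- Non-square class, member `3`. -/
theorem no_design_nsq_mem₃_of_cert (hc : cert (KS p false) false c X₀ = true) (hm : 3 ≤ m)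
    {H₁ H₂ H₃ : Subgroup (GLm p m)}
    (h₃ : ∀ b : Fin m → ZMod p, ¬ IsSquare (b ⬝ᵥ b) → refl b ∈ H₃) :
    ¬ ∃ f : Mat p m → ℂ, (∀ M, 1 < M.rank → f M = 0) ∧
      (∑ M, f M * ZMod.stdAddChar (Matrix.trace (M * ((1 : GLm p m) : Mat p m)))) = 1 ∧
      ∀ a ∈ H₁, ∀ b ∈ H₂, ∀ g ∈ H₃, a * b * g ≠ 1 →
        (∑ M, f M * ZMod.stdAddChar (Matrix.trace (M * ((a * b * g : GLm p m) : Mat p m)))) = 0 :=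
  by
  obtain ⟨l, rfl⟩ := Nat.exists_eq_add_of_le hm
  intro hdes
  refine no_design_of_cert (H₁ := H₁.comap (emb finSumFinEquiv))
    (H₂ := H₂.comap (emb finSumFinEquiv)) (H₃ := H₃.comap (emb finSumFinEquiv)) hc
    (triple_of_le₃ ((Subgroup.closure_le _).mpr ?_)) (design_comap finSumFinEquiv 1 hdes)
  rintro _ ⟨b, -, hb, rfl⟩
  refine Subgroup.mem_comap.mpr ?_
  rw [emb_refl]
  exact h₃ _ (by rw [extVec_dotProduct]; exact of_decide_eq_false hb)

end Exclusions

end ReflectionClassCertificate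
end Summit.MatrixMultiplication.MatrixMultiplication.Theorems.SubgroupIdentityDesigns.Negative
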